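import Summits.AtomisticToContinuum.HydrodynamicLimit.Theses.RingDensityCertificate
import Summits.AtomisticToContinuum.HydrodynamicLimit.Theorems.RingDensityCertificateTiltTransferTools
import HarnessLib

/-!
# `TiltTransfer` (support item stmt-AtomisticToContinuum-12131, route `RingDensityCertificate`)

Cauchy–Schwarz transfer of events against the invariant homogeneous law, dilute form: for
`0 < σ < 1/4`, continuous profiles `a₀, θ₀ > 0`, `u₀` and a temperature `θc` with `θ₀ < 2θc` pointwise
there is `Λ` such that for every particle number `N + 1`, every hard-sphere flow `Φ`, every time `t`
and every measurable `B`,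
`(lawAt Φ P_N t)(B) ≤ e^{Λ(N+1)} · Q_N(B)^{1/2}`,
`P_N = localGibbsLaw σ a₀ u₀ θ₀ N Φ`, `Q_N = localGibbsLaw σ 1 0 θc N Φ` (the homogeneous law).

## Proof

* Static `L²` bound (`core_bound`, flow-free): `P_N(A) ≤ e^{Λ(N+1)} Q_N(A)^{1/2}` for every measurable
  `A`. Both laws have densities `Z_P⁻¹ 𝟙_D f_P^{⊗}` and `Z_Q⁻¹ 𝟙_D f_Q^{⊗}` with respect to Lebesgue
  measure on phase space (`localGibbsLaw_eq`, `localGibbsMeasure`). Pointwise Gaussian domination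
  (`profile_sq_le`, tools file): `f_P(x,v)² ≤ K₀ · M_{1,0,θ''}(v) · M_{1,0,θc}(v)` — this is where
  `θ₀ ≤ θmax < 2θc` enters. Hence `(Z_P⁻¹ i_P)² ≤ R · (Z_Q⁻¹ i_Q)` with
  `R = (Z_Q/Z_P²) K₀^{N+1} 𝟙_D M_{θ''}^{⊗}` and Hölder (`ENNReal.lintegral_mul_le_Lp_mul_Lq`, `p = q = 2`)
  gives `P(A) ≤ (∫ R)^{1/2} Q(A)^{1/2}`. Integrating the velocities first
  (`lintegral_gibbsWeight_mul`, `canonicalPartition_eq_posPartition`) the configurational partition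
  function `V = posPartition 1 ε (N+1) > 0` (`posPartition_pos`, `σ ≤ 1/2`) CANCELS:
  `∫ 𝟙_D M_{θ''}^{⊗} = V`, `Z_Q = V`, `Z_P ≥ a_min^{N+1} V`, so `∫ R ≤ (K₀/a_min²)^{N+1} ≤ e^{L(N+1)}`,
  `L = K₀/a_min²`, `Λ = L/2`. No free-volume lower bound (sequential insertion) is needed.
* Invariance: `Q_N(Φ_t⁻¹ B) = (lawAt Φ Q_N t)(B) = Q_N(B)` by the route's proved support item
  `HomogeneousInvariance_holds` (Liouville + energy/momentum conservation).

References: C. Kipnis, C. Landim, *Scaling Limits of Interacting Particle Systems* (1999), Ch. 10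
(transfer against the invariant state); H. Spohn, *Large Scale Dynamics of Interacting Particles*
(1991), Part I §2.3; I. Gallagher, L. Saint-Raymond, B. Texier, *From Newton to Boltzmann* (2013),
Prop. 4.1.1.
-/

noncomputable section

namespace Summit.AtomisticToContinuum.HydrodynamicLimit.Theorems

open MeasureTheory Filter Set Real
open scoped ENNReal
open Literature.Analysis.FluidPDE Literature.MathematicalPhysics.KineticTheory

namespace RingDensityCertificateTiltTransfer

variable {a₀ θ₀ : T3 → ℝ} {u₀ : T3 → V3} {θc : ℝ}

/-! ### The static `L²` tilt bound -/

/-- **Static `L²` tilt bound** (flow-free form of `TiltTransfer`): for `σ ≤ 1/2` and profiles as in the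
item there is `Λ` with `P_N(A) ≤ e^{Λ(N+1)} Q_N(A)^{1/2}` for every `N` and every measurable `A`,
`P_N, Q_N` the local Gibbs measures with profiles `(a₀,u₀,θ₀)` and `(1,0,θc)`. Cauchy–Schwarz with
the Gaussian domination; the configurational partition function cancels. [folklore] -/
theorem core_bound {σ : ℝ} (hσ2 : σ ≤ 1 / 2) (ha : Continuous a₀) (hθ : Continuous θ₀)
    (hu : Continuous u₀) (ha0 : ∀ x, 0 < a₀ x) (hθ0 : ∀ x, 0 < θ₀ x) (hθc : ∀ x, θ₀ x < 2 * θc) :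
    ∃ Λ : ℝ, ∀ (N : ℕ) (A : Set (Config (N + 1) (Fin 3) T3)), MeasurableSet A →
      localGibbsMeasure σ a₀ u₀ θ₀ N A ≤
        ENNReal.ofReal (Real.exp (Λ * (N + 1))) *
          (localGibbsMeasure σ 1 0 (fun _ => θc) N A) ^ (1 / 2 : ℝ) := by
  obtain ⟨θ'', K₀, hθ'', hK₀, hdom⟩ := profile_sq_le ha hθ hu ha0 hθ0 hθc
  obtain ⟨xm, -, hxm⟩ := isCompact_univ.exists_isMinOn univ_nonempty ha.continuousOn
  have hamin0 : 0 < a₀ xm := ha0 xm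
  have hamin : ∀ x, a₀ xm ≤ a₀ x := fun x => isMinOn_iff.1 hxm x (mem_univ x)
  have hθc0 : 0 < θc := by
    have h1 := hθc xm
    have h2 := hθ0 xm
    linarith
  have ha0' : ∀ x, 0 ≤ a₀ x := fun x => (ha0 x).le
  set L := K₀ / a₀ xm ^ 2 with hL
  have hL0 : 0 ≤ L := by positivity
  refine ⟨L / 2, fun N A hA => ?_⟩
  -- names
  set ε := hsDiameter σ N with hε
  set fP : T3 × V3 → ℝ := localGibbsProfile a₀ u₀ θ₀ with hfP
  set fQ : T3 × V3 → ℝ := localGibbsProfile 1 0 (fun _ => θc) with hfQ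
  set fR : T3 × V3 → ℝ := localGibbsProfile 1 0 (fun _ => θ'') with hfR
  set D := hardSphereDomain (Torus.geometry (Fin 3)) (N + 1) ε with hD
  set ZP := canonicalPartition (Torus.geometry (Fin 3)) ε (N + 1) fP with hZP
  set ZQ := canonicalPartition (Torus.geometry (Fin 3)) ε (N + 1) fQ with hZQ
  set V := posPartition (1 : T3 → ℝ) ε (N + 1) with hV
  -- partition functions
  have hV0 : 0 < V := posPartition_pos continuous_one (fun _ => one_pos) hσ2 N
  have hZQV : ZQ = V :=
    canonicalPartition_eq_posPartition (a₀ := 1) (u₀ := 0) (θ₀ := fun _ => θc) continuous_one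
      continuous_const continuous_zero (fun _ => zero_le_one) (fun _ => hθc0) ε (N + 1)
  have hZPeq : ZP = posPartition a₀ ε (N + 1) :=
    canonicalPartition_eq_posPartition ha hθ hu ha0' hθ0 ε (N + 1)
  have hZPge : a₀ xm ^ (N + 1) * V ≤ ZP := by
    rw [hZPeq]
    exact pow_mul_posPartition_one_le ha ha0' hamin0.le hamin ε (N + 1)
  have hZP0 : 0 < ZP := lt_of_lt_of_le (by positivity) hZPge
  have hZQ0 : 0 < ZQ := by rw [hZQV]; exact hV0
  -- the three integrands
  set iP : Config (N + 1) (Fin 3) T3 → ℝ := D.indicator (tensorPow (N + 1) fP) with hiP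
  set iQ : Config (N + 1) (Fin 3) T3 → ℝ := D.indicator (tensorPow (N + 1) fQ) with hiQ
  set iR : Config (N + 1) (Fin 3) T3 → ℝ := D.indicator (tensorPow (N + 1) fR) with hiR
  have hfP0 : 0 ≤ fP := fun y => localGibbsProfile_nonneg ha0' (fun x => (hθ0 x).le) y
  have hfQ0 : 0 ≤ fQ := fun y =>
    localGibbsProfile_nonneg (a₀ := 1) (u₀ := 0) (θ₀ := fun _ => θc) (fun _ => zero_le_one)
      (fun _ => hθc0.le) y
  have hfR0 : 0 ≤ fR := fun y =>
    localGibbsProfile_nonneg (a₀ := 1) (u₀ := 0) (θ₀ := fun _ => θ'') (fun _ => zero_le_one)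
      (fun _ => hθ''.le) y
  have hiP0 : ∀ z, 0 ≤ iP z := fun z =>
    Set.indicator_nonneg (fun w _ => tensorPow_nonneg hfP0 _ w) z
  have hiQ0 : ∀ z, 0 ≤ iQ z := fun z =>
    Set.indicator_nonneg (fun w _ => tensorPow_nonneg hfQ0 _ w) z
  have hiR0 : ∀ z, 0 ≤ iR z := fun z =>
    Set.indicator_nonneg (fun w _ => tensorPow_nonneg hfR0 _ w) z
  have hiQm : Measurable iQ :=
    measurable_indicator_tensorPow (a₀ := 1) (u₀ := 0) (θ₀ := fun _ => θc) continuous_one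
      continuous_const continuous_zero ε (N + 1)
  have hiRm : Measurable iR :=
    measurable_indicator_tensorPow (a₀ := 1) (u₀ := 0) (θ₀ := fun _ => θ'') continuous_one
      continuous_const continuous_zero ε (N + 1)
  -- pointwise Cauchy–Schwarz splitting
  have hpt : ∀ z, ZP⁻¹ * iP z ≤
      Real.sqrt (ZQ / ZP ^ 2 * K₀ ^ (N + 1) * iR z) * Real.sqrt (ZQ⁻¹ * iQ z) := fun z =>
    density_le_sqrt_mul (hiP0 z) (hiQ0 z) (hiR0 z) hZP0 hZQ0 (pow_nonneg hK₀ _)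
      (indicator_tensorPow_sq_le hdom D z)
  set g : Config (N + 1) (Fin 3) T3 → ℝ≥0∞ :=
    fun z => ENNReal.ofReal (Real.sqrt (ZQ / ZP ^ 2 * K₀ ^ (N + 1) * iR z)) with hg
  set h : Config (N + 1) (Fin 3) T3 → ℝ≥0∞ :=
    fun z => ENNReal.ofReal (Real.sqrt (ZQ⁻¹ * iQ z)) with hh
  have hgm : Measurable g := ((measurable_const.mul hiRm).sqrt).ennreal_ofReal
  have hhm : Measurable h := ((measurable_const.mul hiQm).sqrt).ennreal_ofReal
  have hg2 : ∀ z, g z ^ (2 : ℝ) = ENNReal.ofReal (ZQ / ZP ^ 2 * K₀ ^ (N + 1) * iR z) := by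
    intro z
    simp only [hg]
    rw [ENNReal.rpow_two, ← ENNReal.ofReal_pow (Real.sqrt_nonneg _), Real.sq_sqrt]
    have := hiR0 z
    positivity
  have hh2 : ∀ z, h z ^ (2 : ℝ) = ENNReal.ofReal (ZQ⁻¹ * iQ z) := by
    intro z
    simp only [hh]
    rw [ENNReal.rpow_two, ← ENNReal.ofReal_pow (Real.sqrt_nonneg _), Real.sq_sqrt]
    have := hiQ0 z
    positivity
  -- the two laws as integrals of their densities
  have hPA : localGibbsMeasure σ a₀ u₀ θ₀ N A = ∫⁻ z in A, ENNReal.ofReal (ZP⁻¹ * iP z) := by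
    rw [localGibbsMeasure, withDensity_apply _ hA]
    rfl
  have hQA : localGibbsMeasure σ 1 0 (fun _ => θc) N A = ∫⁻ z in A, ENNReal.ofReal (ZQ⁻¹ * iQ z) := by
    rw [localGibbsMeasure, withDensity_apply _ hA]
    rfl
  -- Hölder with p = q = 2
  have hHolder : ∫⁻ z in A, (g * h) z ≤
      (∫⁻ z in A, ENNReal.ofReal (ZQ / ZP ^ 2 * K₀ ^ (N + 1) * iR z)) ^ (1 / 2 : ℝ) *
        (localGibbsMeasure σ 1 0 (fun _ => θc) N A) ^ (1 / 2 : ℝ) := by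
    have hH := ENNReal.lintegral_mul_le_Lp_mul_Lq (volume.restrict A) Real.HolderConjugate.two_two
      hgm.aemeasurable hhm.aemeasurable
    simp only [hg2, hh2] at hH
    rw [← hQA] at hH
    exact hH
  -- the integral of the comparison density
  have hRint : ∫⁻ z, ENNReal.ofReal (ZQ / ZP ^ 2 * K₀ ^ (N + 1) * iR z) =
      ENNReal.ofReal (ZQ / ZP ^ 2 * K₀ ^ (N + 1) * V) := by
    have hc0 : 0 ≤ ZQ / ZP ^ 2 * K₀ ^ (N + 1) := by positivity
    have h1 : ∫⁻ z, ENNReal.ofReal (iR z) = ENNReal.ofReal V := by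
      simp only [hiR, hD, hfR, hV]
      exact lintegral_indicator_tensorPow_one hθ'' ε (N + 1)
    simp_rw [ENNReal.ofReal_mul hc0]
    rw [lintegral_const_mul' _ _ ENNReal.ofReal_ne_top, h1]
  -- the real-variable bound: the configurational partition function cancels
  have hreal : ZQ / ZP ^ 2 * K₀ ^ (N + 1) * V ≤ Real.exp (L * (N + 1)) := by
    have hZPne : ZP ≠ 0 := hZP0.ne'
    have hane : a₀ xm ≠ 0 := hamin0.ne'
    have hVne : V ≠ 0 := hV0.ne'
    have h1 : ZQ / ZP ^ 2 * K₀ ^ (N + 1) * V ≤ L ^ (N + 1) := by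
      rw [hZQV]
      calc V / ZP ^ 2 * K₀ ^ (N + 1) * V = (V ^ 2 * K₀ ^ (N + 1)) / ZP ^ 2 := by
            field_simp
        _ ≤ (V ^ 2 * K₀ ^ (N + 1)) / (a₀ xm ^ (N + 1) * V) ^ 2 :=
            div_le_div_of_nonneg_left (by positivity) (by positivity)
              (pow_le_pow_left₀ (by positivity) hZPge 2)
        _ = L ^ (N + 1) := by
            rw [hL, div_pow, div_eq_div_iff (by positivity) (by positivity)]
            ring
    calc ZQ / ZP ^ 2 * K₀ ^ (N + 1) * V ≤ L ^ (N + 1) := h1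
      _ ≤ Real.exp L ^ (N + 1) :=
          pow_le_pow_left₀ hL0 (by linarith [Real.add_one_le_exp L]) _
      _ = Real.exp (L * (N + 1)) := by
          rw [← Real.exp_nat_mul]
          congr 1
          push_cast
          ring
  -- assembly
  calc localGibbsMeasure σ a₀ u₀ θ₀ N A = ∫⁻ z in A, ENNReal.ofReal (ZP⁻¹ * iP z) := hPA
    _ ≤ ∫⁻ z in A, (g * h) z := by
        refine lintegral_mono fun z => ?_
        simp only [Pi.mul_apply, hg, hh]
        rw [← ENNReal.ofReal_mul (Real.sqrt_nonneg _)]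
        exact ENNReal.ofReal_le_ofReal (hpt z)
    _ ≤ (∫⁻ z in A, ENNReal.ofReal (ZQ / ZP ^ 2 * K₀ ^ (N + 1) * iR z)) ^ (1 / 2 : ℝ) *
          (localGibbsMeasure σ 1 0 (fun _ => θc) N A) ^ (1 / 2 : ℝ) := hHolder
    _ ≤ (ENNReal.ofReal (Real.exp (L * (N + 1)))) ^ (1 / 2 : ℝ) *
          (localGibbsMeasure σ 1 0 (fun _ => θc) N A) ^ (1 / 2 : ℝ) := by
        gcongr
        calc ∫⁻ z in A, ENNReal.ofReal (ZQ / ZP ^ 2 * K₀ ^ (N + 1) * iR z)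
            ≤ ∫⁻ z, ENNReal.ofReal (ZQ / ZP ^ 2 * K₀ ^ (N + 1) * iR z) :=
              setLIntegral_le_lintegral _ _
          _ = ENNReal.ofReal (ZQ / ZP ^ 2 * K₀ ^ (N + 1) * V) := hRint
          _ ≤ ENNReal.ofReal (Real.exp (L * (N + 1))) := ENNReal.ofReal_le_ofReal hreal
    _ = ENNReal.ofReal (Real.exp (L / 2 * (N + 1))) *
          (localGibbsMeasure σ 1 0 (fun _ => θc) N A) ^ (1 / 2 : ℝ) := by
        congr 1
        rw [ENNReal.ofReal_rpow_of_pos (Real.exp_pos _), ← Real.exp_mul]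
        congr 1
        ring

end RingDensityCertificateTiltTransfer

open RingDensityCertificateTiltTransfer in
/-- **`TiltTransfer` holds** (support item stmt-AtomisticToContinuum-12131 of route
`RingDensityCertificate`, concluded BY NAME): for `0 < σ < 1/4`, continuous `a₀, θ₀ > 0`, `u₀` and
`θ₀ < 2θc` there is `Λ` with `(lawAt Φ P_N t)(B) ≤ e^{Λ(N+1)} Q_N(B)^{1/2}` for all `N`, flows `Φ`,
times `t` and measurable `B`. Static `L²` tilt bound (`core_bound`) at `A = Φ_t⁻¹ B` plus invariance
of the homogeneous law `Q_N` (`HomogeneousInvariance_holds`). [folklore] -/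
theorem tiltTransfer_proof :
    Summit.AtomisticToContinuum.HydrodynamicLimit.Theses.RingDensityCertificate.TiltTransfer := by
  unfold Summit.AtomisticToContinuum.HydrodynamicLimit.Theses.RingDensityCertificate.TiltTransfer
  intro σ hσ hσ4 a₀ θ₀ u₀ θc ha hθ hu ha0 hθ0 hθc
  have hσ2 : σ ≤ 1 / 2 := by linarith
  obtain ⟨Λ, hΛ⟩ := core_bound hσ2 ha hθ hu ha0 hθ0 hθc
  refine ⟨Λ, fun N Φ t B hB => ?_⟩
  have hθc0 : 0 < θc := by
    have h1 := hθc 0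
    have h2 := hθ0 0
    linarith
  have hinv : Φ.lawAt (localGibbsLaw σ 1 0 (fun _ => θc) N Φ) t =
      localGibbsLaw σ 1 0 (fun _ => θc) N Φ :=
    Summit.AtomisticToContinuum.HydrodynamicLimit.Theses.RingDensityCertificate.HomogeneousInvariance_holds
      σ 1 θc 0 hσ one_pos hθc0 N Φ t
  have hQ : localGibbsLaw σ 1 0 (fun _ => θc) N Φ B =
      localGibbsMeasure σ 1 0 (fun _ => θc) N (Φ.flow t ⁻¹' B) := by
    calc localGibbsLaw σ 1 0 (fun _ => θc) N Φ B
        = (Φ.lawAt (localGibbsLaw σ 1 0 (fun _ => θc) N Φ) t) B := by rw [hinv]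
      _ = localGibbsMeasure σ 1 0 (fun _ => θc) N (Φ.flow t ⁻¹' B) := by
          rw [HardSphereFlow.lawAt_eq, Measure.map_apply (Φ.measurable_flow t) hB, localGibbsLaw_eq]
  rw [hQ, HardSphereFlow.lawAt_eq, Measure.map_apply (Φ.measurable_flow t) hB, localGibbsLaw_eq]
  exact hΛ N _ (hB.preimage (Φ.measurable_flow t))

end Summit.AtomisticToContinuum.HydrodynamicLimit.Theorems

end
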